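import Mathlib
import Literature.Analysis.OperatorTheory.FredholmAlternativeSurjective

/-!
# Crux `SkeletonJ1R` (stmt-NavierStokesRegularity-23610) · registered line `streamline_kantorovich_R` · stub K-B′ `KantorovichClosingBL1` —
# THE LINEAR STEP OF THE CLOSING: an a-priori bound for a compact perturbation of an isomorphism between Banach spaces makes it an
# isomorphism WITH THE SAME CONSTANT as inverse bound (how the constant `K` of L′ `ReferenceInjectivityL1` becomes `‖DG(x)⁻¹‖` in Newton–Kantorovich)

Hand `leafhand-ns-filamentskeletonrs-1` g2 (prover), 2026-08-31, `--supports stmt-NavierStokesRegularity-23610 --as helper`; pure Mathlib +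
`Literature.Analysis.OperatorTheory.FredholmAlternativeSurjective`, route-independent.  MODEL rung, NEGATIVE side of the NS ladder: the use is in a
line about a HYPOTHETICAL filament-type blow-up skeleton; nothing here bears on Navier–Stokes regularity, which is NOT proved.

WHY (K-notes §2 of the lead, `Cruxes/SkeletonJ1R/Lines/streamline_kantorovich_R_K-notes.md`).  The closing applies `Literature.Analysis.Calculus.
NewtonKantorovich_holds` to `G := I − Φ¹` at the LIA reference; `DG(x) = 𝒯⁻¹ L₁` where `𝒯 : E ≃L F` is the (invertible) streamline transport and
`L₁ = 𝒯 − 𝒯 DΦ¹(x) : E →L F` is the linearised switched-defect operator, a COMPACT perturbation of `𝒯` (`DΦ¹` is compact: the streamline of a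
field one derivative smoother than the skeleton).  Stub L′ supplies exactly an A-PRIORI BOUND `‖Y‖_E ≤ K ‖L₁ Y‖_F` (injectivity with a constant,
`K` uniform in `Γ`).  Newton–Kantorovich needs `DG(x)` INVERTIBLE with a bound on the inverse.  This file is that step, abstractly:

* `injective_of_apriori_bound` — `‖x‖ ≤ K‖S x‖` for all `x` ⇒ `S` injective;
* `bijective_of_injective_of_isCompactOperator_sub` — for `S : X →L Y` with `S − J` compact, `J : X ≃L Y`, `X` Banach: `S` injective ⇒ `S`
  bijective (the INJECTIVE half of the Fredholm alternative, transported from Mathlib's `IsCompactOperator.hasEigenvalue_or_mem_resolventSet` via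
  the Literature file's `bijective_iff_injective_of_isCompactOperator` at `μ = −1` to `K₀ = J⁻¹(S − J)`; the Literature file's `Perturbation`
  section has only the surjective half);
* `exists_equiv_of_apriori_bound` — ★ `S − J` compact and `‖x‖ ≤ K‖S x‖` (`0 ≤ K`, `X`, `Y` Banach) ⇒ `S` is a linear homeomorphism `T` with
  `‖T⁻¹‖ ≤ K` (open mapping theorem `ContinuousLinearEquiv.ofBijective`; the inverse bound is the a-priori bound read backwards);
* `exists_equiv_symm_comp_of_apriori_bound` — the `DG`-form: `J⁻¹ ∘ S : X ≃L X` with `‖(J⁻¹ ∘ S)⁻¹‖ ≤ K‖J‖` (`DG(x)⁻¹ = L₁⁻¹ 𝒯`).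

[F. Riesz 1918; Brezis 2011 Thm 6.6; Deuflhard, Newton Methods for Nonlinear Problems (2011) Thm 2.1 — the hypothesis `‖F′(x₀)⁻¹‖ ≤ β`] [folklore]
-/

set_option linter.dupNamespace false -- `NavierStokesRegularity.NavierStokesRegularity` path/namespace repetition is the tree convention

noncomputable section

namespace Summit.NavierStokesRegularity.NavierStokesRegularity.Theorems.SkeletonJ1RFrame.KantorovichLinearStep

open Function

variable {𝕜 X Y : Type*} [NontriviallyNormedField 𝕜] [NormedAddCommGroup X] [NormedSpace 𝕜 X]
  [NormedAddCommGroup Y] [NormedSpace 𝕜 Y]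

/-- An a-priori bound `‖x‖ ≤ K ‖S x‖` makes a continuous linear map injective. [folklore] -/
theorem injective_of_apriori_bound (S : X →L[𝕜] Y) {K : ℝ} (h : ∀ x, ‖x‖ ≤ K * ‖S x‖) : Injective S := by
  intro x y hxy
  have hb := h (x - y)
  rw [map_sub, hxy, sub_self, norm_zero, mul_zero] at hb
  exact sub_eq_zero.mp (norm_le_zero_iff.mp hb)

/-- The a-priori bound is NECESSARY as well: a linear homeomorphism `T` with `‖T⁻¹‖ ≤ K` satisfies `‖x‖ ≤ K ‖T x‖` (so the constant of
stub L′ and the Kantorovich inverse bound are the same number). [folklore] -/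
theorem apriori_bound_of_equiv (T : X ≃L[𝕜] Y) {K : ℝ} (hTn : ‖(T.symm : Y →L[𝕜] X)‖ ≤ K) (x : X) : ‖x‖ ≤ K * ‖T x‖ := by
  calc ‖x‖ = ‖(T.symm : Y →L[𝕜] X) (T x)‖ := by simp
    _ ≤ ‖(T.symm : Y →L[𝕜] X)‖ * ‖T x‖ := ContinuousLinearMap.le_opNorm _ _
    _ ≤ K * ‖T x‖ := mul_le_mul_of_nonneg_right hTn (norm_nonneg _)

section Banach

variable [CompleteSpace X]

/-- **Fredholm alternative for a compact perturbation of an isomorphism, injective half.**  If `S − J` is compact for a linear homeomorphism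
`J : X ≃L Y`, `X` Banach, then `S` injective ⇒ `S` bijective.  (`S = J ∘ (K₀ − (−1)•1)` with `K₀ = J⁻¹(S − J)` compact on `X`; apply the
Banach-space Fredholm alternative `bijective_iff_injective_of_isCompactOperator` at `μ = −1`.) [folklore] -/
theorem bijective_of_injective_of_isCompactOperator_sub (S : X →L[𝕜] Y) (J : X ≃L[𝕜] Y)
    (hK : IsCompactOperator (S - (J : X →L[𝕜] Y) : X →L[𝕜] Y)) (hinj : Injective S) : Bijective S := by
  set K₀ : X →L[𝕜] X := (J.symm : Y →L[𝕜] X) ∘L (S - (J : X →L[𝕜] Y)) with hK₀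
  have hK₀c : IsCompactOperator K₀ := hK.clm_comp (J.symm : Y →L[𝕜] X)
  have hS : ∀ x, S x = J ((K₀ - (-1 : 𝕜) • 1) x) := by
    intro x
    simp [hK₀]
  have h1inj : Injective (K₀ - (-1 : 𝕜) • 1 : X →L[𝕜] X) := by
    intro x y hxy
    apply hinj
    rw [hS, hS, hxy]
  have h1bij := (Literature.Analysis.OperatorTheory.bijective_iff_injective_of_isCompactOperator hK₀c
    (μ := (-1 : 𝕜)) (neg_ne_zero.2 one_ne_zero)).2 h1inj
  refine ⟨hinj, fun y => ?_⟩
  obtain ⟨x, hx⟩ := h1bij.2 (J.symm y)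
  exact ⟨x, by rw [hS, hx, J.apply_symm_apply]⟩

variable [CompleteSpace Y]

/-- ★ **A-priori bound + compact perturbation of an isomorphism ⇒ isomorphism with the same constant.**  If `S − J` is compact (`J : X ≃L Y`,
`X`, `Y` Banach) and `‖x‖ ≤ K‖S x‖` for all `x` (`0 ≤ K`), then `S` is (the underlying map of) a linear homeomorphism `T : X ≃L Y` with
`‖T⁻¹‖ ≤ K`.  This is how the Γ-uniform constant of stub L′ (`ReferenceInjectivityL1`) enters the Newton–Kantorovich hypothesis `‖F′(x₀)⁻¹‖ ≤ β`
of the closing K-B′. [folklore] -/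
theorem exists_equiv_of_apriori_bound (S : X →L[𝕜] Y) (J : X ≃L[𝕜] Y)
    (hK : IsCompactOperator (S - (J : X →L[𝕜] Y) : X →L[𝕜] Y)) {K : ℝ} (hK0 : 0 ≤ K) (h : ∀ x, ‖x‖ ≤ K * ‖S x‖) :
    ∃ T : X ≃L[𝕜] Y, (∀ x, T x = S x) ∧ ‖(T.symm : Y →L[𝕜] X)‖ ≤ K := by
  have hbij := bijective_of_injective_of_isCompactOperator_sub S J hK (injective_of_apriori_bound S h)
  let T : X ≃L[𝕜] Y :=
    ContinuousLinearEquiv.ofBijective S (LinearMap.ker_eq_bot.mpr hbij.1) (LinearMap.range_eq_top.mpr hbij.2)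
  have hT : ∀ x, T x = S x := fun x => rfl
  refine ⟨T, hT, ContinuousLinearMap.opNorm_le_bound _ hK0 fun y => ?_⟩
  have hy : S (T.symm y) = y := by rw [← hT, T.apply_symm_apply]
  calc ‖(T.symm : Y →L[𝕜] X) y‖ = ‖T.symm y‖ := rfl
    _ ≤ K * ‖S (T.symm y)‖ := h _
    _ = K * ‖y‖ := by rw [hy]

/-- The `DG`-form of the linear step: under the same hypotheses the endomorphism `J⁻¹ ∘ S` of `X` (in the line: `DG(x) = 𝒯⁻¹ L₁`) is a linear
homeomorphism `G` with `‖G⁻¹‖ ≤ K ‖J‖` (`G⁻¹ = S⁻¹ ∘ J`). [folklore] -/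
theorem exists_equiv_symm_comp_of_apriori_bound (S : X →L[𝕜] Y) (J : X ≃L[𝕜] Y)
    (hK : IsCompactOperator (S - (J : X →L[𝕜] Y) : X →L[𝕜] Y)) {K : ℝ} (hK0 : 0 ≤ K) (h : ∀ x, ‖x‖ ≤ K * ‖S x‖) :
    ∃ G : X ≃L[𝕜] X, (∀ x, G x = J.symm (S x)) ∧ ‖(G.symm : X →L[𝕜] X)‖ ≤ K * ‖(J : X →L[𝕜] Y)‖ := by
  obtain ⟨T, hT, hTn⟩ := exists_equiv_of_apriori_bound S J hK hK0 h
  refine ⟨T.trans J.symm, fun x => by simp [hT], ContinuousLinearMap.opNorm_le_bound _ (by positivity) fun x => ?_⟩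
  have hGs : (T.trans J.symm).symm x = T.symm (J x) := rfl
  calc ‖((T.trans J.symm).symm : X →L[𝕜] X) x‖ = ‖T.symm (J x)‖ := by rw [ContinuousLinearEquiv.coe_coe, hGs]
    _ = ‖(T.symm : Y →L[𝕜] X) (J x)‖ := rfl
    _ ≤ ‖(T.symm : Y →L[𝕜] X)‖ * ‖J x‖ := ContinuousLinearMap.le_opNorm _ _
    _ ≤ K * ‖J x‖ := mul_le_mul_of_nonneg_right hTn (norm_nonneg _)
    _ ≤ K * (‖(J : X →L[𝕜] Y)‖ * ‖x‖) :=
        mul_le_mul_of_nonneg_left (ContinuousLinearMap.le_opNorm (J : X →L[𝕜] Y) x) hK0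
    _ = K * ‖(J : X →L[𝕜] Y)‖ * ‖x‖ := by ring

end Banach

end Summit.NavierStokesRegularity.NavierStokesRegularity.Theorems.SkeletonJ1RFrame.KantorovichLinearStep

end
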